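import Summits.ResolutionOfSingularities.ResolutionOfSingularities.Theorems.DeltaFaceCutClasses
import Summits.ResolutionOfSingularities.ResolutionOfSingularities.Theorems.VeryNearCutClasses
import Summits.ResolutionOfSingularities.ResolutionOfSingularities.Theorems.VeryNearCutKernels
import Literature.AlgebraicGeometry.Resolution.StalkSpecializesLocalization
import HarnessLib


/-!
# RelativeDeltaCut — the NON-ISOLATED core cut by the δ-face TRANSVERSAL to a regular top curve and the CURVE
[WRITER NOTE (decomp-res writer g5): tree file 1/3 of the lens-2 g12 node «RelativeDeltaCut» (HOME decomp-res-lens-2/g12/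
RelativeDeltaCut.lean, sha256 29d33530a35d7692, critic row 85 CLEARED): §3–§5 (the NEW classes) VERBATIM,
statement-only; namespace
`…Theorems.RelativeDeltaCut` (the lens's `Theses.RelativeDeltaCut` is gate-reserved).  The lens's §0–§2
«RESTATED VERBATIM from
lens-2 g11 DeltaFaceCut» are DELETED: g11 is the tree's `DeltaFaceCutClasses` (opened).  §6 kernels =
`RelativeDeltaCutKernels`;
the kernels and edges reaching 29273 `MaxContactCut.RungOne`, 32106/32107, 31576/31577 BY NAME =
`MaxContactCutRelativeDeltaCut`.
The lens header below is kept verbatim as the node record.]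
PACKAGE of positive-dimensional centres it dictates (decomp-res lens-2 «structural dichotomy (special vs generic)», g12)

ROOT DECOMPOSITION CELL `decomp-res`, RESIDUAL MODE (D-0179), generation 12.  TARGET (tree items, BY NAME):
`MaxContactCut.RungOne` (stmt-29273, `E 2 → E 1`, the dimension-four core of the order axis in SEQUENCE form), with the
map edges to `MaxContactCut.StepPICoreDimFour` (28544, kernel `MaxContactCutTauLadder.closes`) and to
`MaxContactCut.ClosedPointCoreAll` (30461, kernel `MaxContactCutGenericPointCut.rungOne_iff_core_of_rounds`), and
refinement edges BY NAME to the tree's g10 asides `MaxContactCut.VNGenericRung` 32106 / `VNSpecialRung` 32107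
(`Theorems.VeryNearCutClasses/Kernels`, `Theorems.MaxContactCutVeryNearCut`), to the g9 asides `FFGenericRung` 31576 /
`FFSpecialRung` 31577, and to lens-2 g11 `DeltaFaceCut` (critic CLEARED 2026-08-30T10:36:50Z, writer filing pending —
its §0–§2 vocabulary (`uDeg … DeltaGenericFace`, `PackageExitsAt`, `DeltaPackageExit`, `IsPackageExitPt`), its classes
`IsDeltaGenericPt / IsDeltaSpecialPt` and its schemas `SeqDGen / SeqDSpec / SeqDSpecNonIso`, `DeltaGenericRung /
DeltaSpecialRung` are RESTATED VERBATIM in §0–§2 of this file and become `open …Theorems.DeltaFaceCutClasses` on filing;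
nothing of g9/g10/g7 is re-typed).

CRITIC DIRECTION HONOURED (CRITIC-LEDGER row 87 + the g11 clearance): «27 of the 30 in-frame located rows (T-delta-bed)
are NON-ISOLATED top points; no point-centred engine (g9 `FaceFormExit`, g10 `VeryNearExit`, g11 `DeltaPackageExit`)
touches them BY DEFINITION; the next lens-2 object is the δ-face TRANSVERSAL to a regular positive-dimensional centre
inside the top locus».  THIS NODE'S NEW OBJECT is exactly that: the RELATIVE δ-FACE PRESENTATION at a closed point `y` of
a top curve `C = closure {η}` — g11's ring-level `HasDeltaFace c J n a b F` and `DeltaGenericFace F̄ n a b` VERBATIM, but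
with `(c) = 𝔭_{C,y} := 𝔪_η ∩ 𝒪_{Y,y}` (the prime of the curve at `y`: tree dictionary `StalkSpecializesLocalization`,
«primes of the stalk = generisations») in place of `(c) = 𝔪_y`, the INERT parameters `v` of `C` at `y` riding as
non-units of the coefficient ring `𝒪_{Y,y}` (so weight = TRANSVERSAL weight, and `v`-multiples of face monomials die in
`F̄ = F mod 𝔪_y`); and the CURVE PACKAGE `(C, C₁, …, C_{m−1})`, `m = ⌈δ⌉ − 1`, of
POSITIVE-DIMENSIONAL regular centres
`C_j = Top(I^{(j)}) ∩ E_j` (ℙ-bundles over `C`) it dictates.  It is the first lens-2 node whose DECIDED class contains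
non-isolated core points (g9/g10/g11 demanded `IsIsolatedTop`).

## The relative presentation at a closed point `y` of the curve `C = {y' : η ⤳ y'}`

`Y` regular, `I` an ideal sheaf, `n ≥ 2`, `η ∈ Y` NOT closed with every proper specialisation closed (`IsCurvePt η`: `C`
is an irreducible closed subset of dimension one), `y ∈ C` closed, `R := 𝒪_{Y,y}`, `𝔭 := curvePrime (η ⤳ y) =
(𝒪_{Y,y} → 𝒪_{Y,η})⁻¹ 𝔪_η`.  `IsRelDeltaGenericAt I n a b η y` :⟺ there are `c = (z, u₁, …,
u_d) ⊂ R` and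
`v = (v₁, …, v_e) ⊂ R` with `(c) = 𝔭`, `(c, v) = 𝔪_y` MINIMALLY (`spanFinrank 𝔪_y = d + 1 + e`; so
`𝒪_{C,y} = R/(c)` is
regular: `C` is regular at `y`, of codimension `d + 1`, and `e = 1` by catenarity), and `F ∈ R[X₀, …, X_d]` with
`HasDeltaFace c I_y n a b F` (`0 < b < a`, `I_y ⊆ Q(an) := (cᵐ : a m₀ + b|α| ≥ an)`, `I_y ∋ zⁿ + F(c) + G(c)`, `F` on
weight exactly `an` with `z`-degree `< n`, `G` on weight `> an`) and `DeltaGenericFace (F mod 𝔪_y) n a b` (G1 ∨ G2 ∨ G3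
over `k(y)̄`, g11).  `IsUniformDeltaCurve I n a b η` :⟺ `IsCurvePt η` and EVERY closed point of `C` is relatively
δ-generic of the SAME slope `a/b` (with the equicharacteristic guard `char k(y) = char κ(η)`, automatic over a
field).  (At `δ = a/b`: `Q(an) ⊆ (c)ⁿ = 𝔭ⁿ` since a monomial of weight `≥ an` with `a > b`
has `c`-degree `≥ n`; hence `ord_y I ≥ n` and, localising, `I_η ⊆ 𝔭ⁿ𝒪_{Y,η} = 𝔪_ηⁿ`, `ord_η I
≥ n`: `C ⊆ Supp(I, n)`
automatically, and `τ = 1` with cotangent directrix line `k·Z̄` at every point of `C`, closed or generic, because the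
degree-`n` part of any `g ∈ Q(an)` is a multiple of `Zⁿ`.)

## THE ENGINE `UniformCurvePackageExit` (DECIDED — paper proof here = g11 (0)–(3) run over `R = 𝒪_{Y,y} ⊃ v`;
characteristic free, EVERY regular scheme, EVERY residue field, every dimension; port L over the tree's `CentreSeq` /
`controlledTransform` / `stalkTau` apparatus, sibling ports as g11)

CLAIM.  `Y` regular and locally noetherian, `n ≥ 2`, `IsUniformDeltaCurve I n a b η`, `C := {y' : η ⤳ y'}`.  Then
`PackageExitsOver I n C`: the CURVE PACKAGE `s = (π₁, …, π_m)`, `m = ⌈a/b⌉ − 1` — `π₁` the blow-up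
of the reduced curve
`C`, `π_{j+1}` the blow-up of `C_j := Top(I^{(j)}) ∩ E_j` — is WEAKLY ADMISSIBLE for `(I, ∅, n)`, has all centres over
`C` and regular top, and EXITS: every point `x` of `Y_m` over `C` with `ord_x I^{(m)} = n` has `τ(x) ≥ 2` (none under G1).

PROOF.  (0r) THE LOCAL MODEL IS g11's.  Fix a closed `y ∈ C` and its presentation `(c, v, F, G)`.  Steps (0)–(3) of
g11 (`DeltaFaceCut` module docstring, re-walked by the critic at clearance) are computations in the A-, B- and z-charts of the
blow-ups of the centres `V(z, u)` and `V(z_j, u₁)` over the chart rings `R[z_j, ũ]`; they use about `R` ONLY: `R`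
regular local, `c` part of a regular system of parameters of `R`, `J ⊆ Q(an)`, `zⁿ + F(c) + G(c) ∈ J`, and the residue
map `R → k(y)` to read `F̄` — NEVER that `(c)` is all of `𝔪_R`.  Run them verbatim with `R = 𝒪_{Y,y}`
(the inert `v` are
just further elements of `R`): the first centre is `V(c) ×_Y Spec R = C ×_Y Spec R`, the `j`-th is `V(z_j, u₁) = C_j`,
`E_j = {u₁ = 0}` in the A-chart, and the exponent bookkeeping `e_j(i, α) = |α| − j(n − i) ≥ (δ − j)(n − i)` is
unchanged (coefficients `r ∈ R` ride along).  SPREADING: the stalk inclusion `I_y ⊆ Q_y(an)` and `zⁿ + F + G ∈ I_y`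
hold on an open `V ∋ y` with sections representing `c, v` and the coefficients (finitely many generators of `I|_V`,
each an `𝒪(V)`-combination of weighted monomials — shrink `V`); `η ∈ V`; so the model describes `I` and all its
transforms over the whole of `V`, in particular over `C ∩ V ∋ η`.  (1r) ADMISSIBILITY: `C` is regular (at each closed
point `𝒪_{C,y} = R/(c)` with `c` part of a minimal system) and `C ⊆ Supp(I, n)` (above), so `π₁` (centre: the vanishing
ideal sheaf of the closed set `C`, tree `IdealSheafData.vanishingIdeal`) is weakly admissible; `C_j ⊆ Supp(I^{(j)}, n)`
for `1 ≤ j ≤ m − 1` over each `V` exactly as g11 (1) (lower bounds `ord ≥ i + e_j ≥ n` from `J ⊆ Q(an)`, no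
cancellation).  (2r) LOCATION AND GLUING: on `E_j` the transform is `≡ z_jⁿ (mod u₁)` in the A-chart and a unit in the
B- and z-charts (g11 (2)), so over `V`: `Top(I^{(j)}) ∩ E_j = V(z_j, u₁) = C_j` — the centres are INTRINSIC closed sets
(`Top ∩ E_j`), hence the local models at different closed points of `C` GLUE with no further argument, and each `C_j`
is regular (locally `V(z_j, u₁)` in a regular chart) — globally `C₁ = ℙ(N_{C/H}) ⊂ ℙ(N_{C/Y}) = E₁` is the
`ℙ^{d−1}`-sub-bundle over `C` cut out by the transversal directrix and `C_{j+1} ≅ C_j` is a section of the `ℙ¹`-bundle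
`E_{j+1} → C_j`; every `Y_j` is regular (blow-ups of regular schemes in regular centres, [Hartshorne1977] II 8.24,
[CossartJannsenSaito2020] Ch. 2); near points of `Y_j` over `C ∩ V` lie on `C_j` (`1 ≤ j ≤ m`).  COVERING: a point `x`
of `Y_m` over `C` lies over `η` or over a closed `y ∈ C`; in the second case it is in `y`'s model; in the first it lies
over EVERY `V(y₀)`, `y₀ ∈ C` closed (`η ∈ V(y₀)` because `V(y₀)` is an open set meeting `C = closure
{η}`; and `C` HAS
closed points: `IsCurvePt`), so it is in the model of any closed point of `C`.  (3r) THE TEST at a point `x ∈ C_m`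
over `V`: g11's
x-prepared expansion `f^{(m)} = z_mⁿ + Σ z_mⁱ u₁ᵉ A_{i,e}` holds on the chart over `V` with `A_{i,e} ∈
R[ũ]`; `gr_x` is now
`κ(x)[Z, U₁, W, V̄]` (`W` lifting parameters of the fibre `ℙ^{d−1}`, `V̄` the inert parameters) — still a polynomial
DOMAIN bigraded by `(deg_Z, deg_{U₁})`, so the cancellation-free readings (N) `ord_x f^{(m)} = min(n, min (i + e +
s_{i,e}))` and (I) (the product-minimal bidegree component of `in_n` survives) hold verbatim, with `s_{i,e} = ord_x A_{i,e}`
now counting `V̄`-degree as well; at a point `x` over `y` the face entries reduce through `R → k(y)` to `Ψ_i(1, Ũ)` built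
from `F̄ = F mod 𝔪_y` (a coefficient `r ∈ R` contributes `in(r) = r̄ +` terms of positive `V̄`-degree, which
only enlarge
`s`), and G1 / G2 / G3 conclude as in g11: under G1 no near point over `y`; under G2 (`n = pᵉ`, `p = char k(y) =
char κ(x)` for every `x` over `C` by the
equicharacteristic guard; the mixed monomial `Zⁱ U₁ᵉ W^β` of (I) is `V̄`-free and is not cancelled by the
`V̄`-terms) and
G3 (`δ ∈ ℤ`; if `in_n = λ·Lⁿ` then its restriction to `W = V̄ = 0`, which is exactly g11's binary form
`Zⁿ + Σ Ψ_i(w) Zⁱ U₁^{n−i}` — no tail term reaches bidegree `(i, n−i)` when `δ ∈ ℤ` — would be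
an `n`-th power of a
linear form, contradicting G3 at `y`) every near point over `y` has `τ ≥ 2`.  Points over `η`: there the face
entries reduce through `R → κ(η) = K(C)` to
`F_η := F ⊗ κ(η)`, and `F_η` IS δ-generic: the G1- and G2-bad loci `{w : μ_i(w) ≥ θ(n−i) ∀ i}` (resp. `>`) are CLOSED in the
`ℙ^{d−1}`-bundle `C_m → C ∩ V` (upper semicontinuity of multiplicity), the G3-solvable locus is closed (preimage of the
image of the FINITE morphism `t ↦ (binom(n,i) t^{n−i})_i`, as in g11 (3)), the bundle is proper over `C ∩ V`, so the image
of a bad locus is closed in `C ∩ V`; it misses the closed point `y` (genericity at `y` is over `k(y)̄`, i.e. the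
geometric fibre is empty), hence misses `η` (a closed subset of the irreducible curve `C ∩ V` containing `η` is
everything).  So (3) applies at points over `η` too.  ∎  WHY UNIFORMITY AT EVERY CLOSED POINT: at a δ-JUMP point `y₀`
(`F ≡ vᵏ·F₀`, `F̄ = 0`; bed `Z⁴ + x²y⁶`) the reading (N) acquires the `v`-adic order `k` of the face
coefficient and the
verdict changes (leaf JUMP below); WHY `IsCurvePt` (dimension one): for a top SURFACE the loci `Top ∩ E_j` are
sub-bundles only off a codimension-two subset of the centre and need not be regular (leaf TANGLE); WHY Top-ISOLATION is
NOT an engine hypothesis: it is needed only by the PORT (units pairwise disjoint), see `IsCurveExitPt`.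

## THE PORT `CurvePackagePort n` [COSTUME(M+) · engine-free bookkeeping = g11's `PackagePort` with curve units]

If every top point of a dim-4 datum is of class ≥ 2, a class-2-form EXIT point of g10 (`IsNearExitPt`), a PACKAGE-EXIT
point of g11 (`IsPackageExitPt`) or a CURVE-EXIT point (`IsCurveExitPt`: on a Top-ISOLATED one-dimensional
`C = closure {η}` with `PackageExitsOver I n C`), then `SeqDimFour 2 n` already yields a weak resolution.  Proof: `Top =
{ord = n} = {ord ≥ n}` is closed, noetherian; the UNITS — isolated closed exit points, and Top-isolated curves `C` (open
and closed in `Top`, irreducible, hence connected components of `Top`) — are pairwise DISJOINT (two Top-isolated top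
curves that meet coincide: `C′ ⊆ Top`, so `C′ ∩ U_C` is a non-empty open of the irreducible `C′` inside
`Top ∩ U_C ⊆ C`, whence `C′ ⊆ C`, `η′ = η`; an isolated top point on `C ⊆ Top` would be open in `C`)
and finitely many
(`≤` number of connected components of `Top`); every top point off the units is of class ≥ 2 (`η` itself is covered by
its own curve: `η ⤳ η`).  Process the units one at a time: the package of the first is a weakly admissible prefix with
centres over the unit; off the preimage of the unit the composite is an isomorphism (each blow-up is an isomorphism off
its centre, and the centres lie over the unit), so orders, `τ`, contact, the isolation neighbourhoods (intersected with
the open complement of the unit) and the packages of the remaining units (restricted to that open complement, tree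
`CentreSeq.restrict`, then read in the transformed scheme — their centres stay closed because they lie over a closed set
disjoint from the processed unit) are transported verbatim (`IsBlowup.idealOrder_controlledTransform_eq_of_not_mem_support`);
over the unit every point of order `n` has `τ ≥ 2`, i.e. `ClassGE … 2`; `ord ≤ n` persists under weakly admissible
blow-ups ([CossartPiltant2008] Prop. 4.2 (a); [CossartJannsenSaito2020] Ch. 2).  After the last unit apply `SeqDimFour 2 n`
to the transformed FRESH datum (the boundary is not read by `WeakAdmissible` / `WeakResolution`) and concatenate
(`CentreSeq.append`, `transformMarked_append`).  [cite: BierstoneGrigorievMilmanWlodarczyk2011 Def. 3.1.3;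
CossartPiltant2008 Prop. 4.2]

## Pieces, tags, «why strictly weaker», edges (NODE-g12.md has the table with evidence and leaves)

* `RelGenericRung` [WEAKER · DECIDED-MOD-PORT(M+)]: `E 2 →` weak order reduction for data ALL of whose top points are of
  class ≥ 2, near-generic (g10, tree engine `VeryNearExit`), δ-generic (g11, engine `DeltaPackageExit`) or CURVE-GENERIC
  (on a Top-isolated uniformly δ-generic curve; engine `UniformCurvePackageExit`); kernel `relGenericRung_of_engines`
  from the three engines, the port `CurvePackagePort n` [COSTUME(M+)] and the tree port `OrderOneContact` [COSTUME(S)].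
  Strictly weaker: its data class excludes every datum with a relatively special core point (bed: CossartPiltant2019
  Rem. 3.2, Giraud's quadric, the kangaroo cylinder); decided: engines paper-proved, ports bookkeeping.
* `RelSpecialRung` [WEAKER BY LETTER · located residual · UNDECIDED · cofinal ⇒ score 0]: data with a RELATIVELY SPECIAL
  core top point (not of class ≥ 2, not near- or δ-generic, on NO Top-isolated uniformly δ-generic curve); EXACT:
  `RungOne ⟺ RelGenericRung ∧ RelSpecialRung` (`rungOne_iff`); ISOLATION sub-cut `RelSpecialRung ⟺ NonIso ∧ Iso`
  (`relSpecialRung_iff_iso`) and the NEW sub-cut of the non-isolated column `NonIso ⟺ Curve ∧ Tangle`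
  (`seqRSpecNonIso_iff`: CURVE = some non-isolated relatively special point lies on a Top-isolated one-dimensional
  `closure {η}` — the column where the relative invariants live: δ-JUMP points, uniformly special curves, relative slope
  one («FLAT»), pinch points `τ(η) ≥ 2 > τ(y)`; TANGLE = none does: crossings of top curves, top surfaces, curves through
  surfaces — Round material of g7 BY NAME).
* Edges BY NAME (§7): `RelGenericRung → VNGenericRung` (32106) `→ FFGenericRung` (31576); `FFSpecialRung` (31577) `→
  VNSpecialRung` (32107) `→ DeltaSpecialRung` (g11) `→ RelSpecialRung`; `VNSpecialRung ⟺ RelSpecialRung` modulo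
  `RelGenericRung` (honesty); `SeqDSpecNonIso n → SeqRSpecNonIso n` (g11's non-isolated column shrinks BY LETTER: the
  curve-generic points leave it); `closes_core` (28544), `closes_closedPointCore` (30461).

## HONESTY IN g7/g8 CURRENCY (confinement by codimension, tree asides 30458–30461, 31129–31132)

Every bed row is a PRINCIPAL hypersurface datum; a top CURVE in a threefold / surface chart has codimension 3 / 2 and a
top surface codimension 2, so in CONFINEMENT currency every in-frame NonIso bed row is Round material: `RoundCodimTwoAll`
(30458, DECIDED) and `RoundCodimThreePrincipalAll` (30459, KNOWN-MOD-PORT [CossartJannsenSaito2020]); the schema-level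
open content of the non-isolated column is `RoundCodimThreeAll` for NON-principal ideals (30460) plus the closed-point
core `ClosedPointCoreAll` (30461), and by g8's dictionary the transversal δ-face at `η` IS g11's δ-face at the closed
point `η` of the generic-fibre threefold `Y ×_C Spec κ(η)`.  What THIS node adds is in EXIT currency: an EXPLICIT,
face-dictated package with positive-dimensional centres and a proof that it exits, for a typed class of non-isolated core
points — the currency in which `RungOne` is actually cut by lens-2 (g9–g11), and the one the E-ladder port consumes.

## Bed (desk reading of g11's T-delta-bed NONISO column, 27 in-frame rows; instrument asks in NODE-g12.md)

DECIDED (uniformly δ-generic Top-isolated curve; cylinders over g11-GENERIC plane-curve points) 3: `bed:cuspline:2:m5`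
(`y² + x⁵` along `w`, slope 5/2, G1, package `(C, C₁)`), `bed:cuspGamma:2:b3` (`z² + y³` along `x`, slope 3/2, G1,
package `(C)`), `bed:cuspGamma:3:b4` (`z³ + y⁴`, `p = 3`, slope 4/3, G1) — each checked by hand against the actual
blow-up of the line (no near points).  CURVE column, not decided: JUMP 3 (`KV59 Z⁴ + x²y⁶`, `insep:3:xy10`,
`insep:5:xy26`: generic of slopes 3/2, 10/3, 26/5 at `x ≠ 0`, `F̄ = 0` at the origin; in all three the SAME package run
through the jump point still exits — the near point of `Z′⁴ + x²y²` has initial form `(Z′² + XY)²`, `τ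
= 3 ≥ 2`; `Z₃³ + xy`
and `Z₅⁵ + xy` have order `2 < n` — because the reading (N) counts the `v`-adic order of the face coefficient:
leaf JUMP, IDEA-NEEDED = relative genericity over
`𝒪_{C,y}` instead of `k(y)`); FLAT-1 4 (relative slope ONE, `J ⊄ Q(an)` for every `a > b` because of a `v`-linear term of
transversal degree `n`: Whitney `Z² + xy²` and `monomialcyl Z² + y²z` in `p = 2` (core along the double line since
`Z² + x₀y² = (Z + √x₀ y)²` over perfect `k`), `ppinch:p3e1 Z³ + w³u`, `frobline Z³ − x³t`; ONE
blow-up of the curve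
resolves each (`Z′² + x`, `Z′³ + u`, … have order 1): leaf FLAT, IDEA-NEEDED = normal-cone-jump exit); FLAT-δ 4
(uniformly δ-special of slope `> 1`: `HauserE7 Z² + yz⁴`, `ppinch:e2 Z² + xy⁴`, `ppinch:p3e2 Z³ + w⁹u`, Narasimhan's
`Z² + yz³ + zw³` along the `y`-axis: G3-solvable at every `y₀ ≠ 0` (`δ ∈ ℤ`) resp., for Narasimhan
(slope `3/2`, `d = 2`),
G1- and G2-bad at the direction `(0 : 1)`; `F̄ = 0` at the origin; genuinely multi-round transversal problems — Round
material BY NAME 30458/30459).  TANGLE column 13 (crossing top curves `HauserK2/K3`, `z²+x³y³`, `insep x⁴y⁴ / x⁶y⁶`,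
`crosscusp`, `WQ3:3`; top surfaces `toric3`, `toyB`, `toyAK`, `conveyorN3`, `rcaploop`, `HP2019-oneblowup`).  Bed margin of
the decided class: +3 rows (g11: +5 isolated rows); predicted next margin (JUMP + FLAT-1): +7.
-/

open CategoryTheory AlgebraicGeometry TopologicalSpace IsLocalRing
open Literature.AlgebraicGeometry.Resolution
open Summit.ResolutionOfSingularities.ResolutionOfSingularities.Theorems
open Summit.ResolutionOfSingularities.ResolutionOfSingularities.Theorems.WeakOrderReduction
open Summit.ResolutionOfSingularities.ResolutionOfSingularities.Theorems.DeltaFaceCutClasses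

namespace Summit.ResolutionOfSingularities.ResolutionOfSingularities.Theorems.RelativeDeltaCut

/-! ## §3  NEW (g12): the δ-face RELATIVE to a top curve — the curve prime, the transversal presentation, uniform
curves, Top-isolated closures, packages over a set, the ENGINE, the curve PORT -/

/-- **The prime of the curve `closure {η}` at `y`**: for a specialisation `h : η ⤳ y`, `curvePrime h :=
(𝒪_{Y,y} → 𝒪_{Y,η})⁻¹ 𝔪_η ⊂ 𝒪_{Y,y}` (tree `StalkSpecializesLocalization`: `𝒪_{Y,η}` is the
localisation of `𝒪_{Y,y}`
at it; «primes of the stalk = generisations of the point»).  DEFINITION (NEW object, support). (Sources: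
StacksProject Tag 01J7; EGA I 2.4.2.) -/
noncomputable def curvePrime {Y : Scheme.{0}} {η y : Y} (h : η ⤳ y) : Ideal (Y.presheaf.stalk y) :=
  (maximalIdeal (Y.presheaf.stalk η)).comap (Y.presheaf.stalkSpecializes h).hom

/-- **RELATIVE δ-GENERICITY at `y` transversal to `η`** (`IsRelDeltaGenericAt I n a b η y`): regular parameters
`c = (z, u₁, …, u_d)` of `𝒪_{Y,y}` generating the curve prime `curvePrime (η ⤳ y)`, extendable by inert parameters
`v = (v₁, …, v_e)` to a MINIMAL system of `𝔪_y` (`spanFinrank = d + 1 + e`: the curve is regular at `y` of codimension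
`d + 1`), and a δ-face presentation of slope `a/b` in the parameters `c` — g11's `HasDeltaFace c (I_y) n a b F`
VERBATIM over the coefficient ring `𝒪_{Y,y} ∋ v` — whose δ-initial form `F mod 𝔪_y ∈ k(y)[Z, U]` is δ-generic
(`DeltaGenericFace`, G1 ∨ G2 ∨ G3).  DEFINITION (NEW object: the transversal δ-face). (Sources: Hironaka1967;
CossartJannsenSaito2020 Ch. 8 (polyhedra for a permissible centre `V(z, u₁, …, u_d)`); CossartPiltant2008 Prop. 4.2.) -/
def IsRelDeltaGenericAt {Y : Scheme.{0}} (I : Y.IdealSheafData) (n a b : ℕ) (η y : Y) : Prop :=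
  ∃ h : η ⤳ y, ∃ (d e : ℕ) (c : Fin (d + 1) → Y.presheaf.stalk y) (v : Fin e → Y.presheaf.stalk y),
    Ideal.span (Set.range c) = curvePrime h ∧
      Ideal.span (Set.range c ∪ Set.range v) = maximalIdeal (Y.presheaf.stalk y) ∧
      (maximalIdeal (Y.presheaf.stalk y)).spanFinrank = d + 1 + e ∧
      ∃ F : MvPolynomial (Fin (d + 1)) (Y.presheaf.stalk y),
        HasDeltaFace c (stalkIdeal I y) n a b F ∧
          DeltaGenericFace (MvPolynomial.map (residue (Y.presheaf.stalk y)) F) n a b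

/-- **`IsCurvePt η`** — `η` is NOT closed and every proper specialisation of `η` is a closed point: `closure {η} =
{y : η ⤳ y}` is an irreducible closed subset of DIMENSION ONE with generic point `η`.  DEFINITION (support).
[folklore] -/
def IsCurvePt {Y : Scheme.{0}} (η : Y) : Prop :=
  ¬ IsClosed ({η} : Set Y) ∧ ∀ y : Y, η ⤳ y → y ≠ η → IsClosed ({y} : Set Y)

/-- **Top-ISOLATED closure** (`IsTopIsolatedClosure I n η`): `η` is itself a point of order `n` (so `closure {η}`
lies in the order-`≥ n` locus by semicontinuity — in the frame `ord ≤ n`, inside the top locus) and some open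
`U ⊇ closure {η}` meets the order-`n` locus of `I` only inside `closure {η}` — the TOP curve `closure {η}` is a connected
component of the top locus (no other top curve or top surface passes through it; two such closures are disjoint or
equal); the positive-dimensional analogue of the tree's `FaceFormCutClasses.IsIsolatedTop`.  Needed by the PORT only
(units pairwise disjoint), not by the engine.  DEFINITION (NEW class predicate). [folklore] -/
def IsTopIsolatedClosure {Y : Scheme.{0}} (I : Y.IdealSheafData) (n : ℕ) (η : Y) : Prop :=
  idealOrder I η = ((n : ℕ) : ℕ∞) ∧
    ∃ U : Y.Opens, (∀ y : Y, η ⤳ y → y ∈ U) ∧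
      ∀ x : Y, x ∈ U → idealOrder I x = ((n : ℕ) : ℕ∞) → η ⤳ x

/-- **UNIFORMLY δ-GENERIC CURVE of slope `a/b`** (`IsUniformDeltaCurve I n a b η`): `η` is a curve point and EVERY
closed point of `closure {η}` is relatively δ-generic transversal to `η`, with the same slope — together with the
EQUICHARACTERISTIC GUARD `char k(y) = char κ(η)` (automatic for schemes over a field, i.e. everywhere in the frame; it is
what lets g11's G2 step — «a mixed monomial cannot occur in `L^{pᵉ}`» — run at the near points over `η`, and it keeps
the ENGINE true on every regular scheme, mixed characteristic included).  (Then `closure {η} ⊆ Supp(I, n)`, the curve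
is regular, and `τ = 1` along it with transversal directrix `Z̄` — module docstring.)  The hypothesis of the ENGINE.
DEFINITION (NEW class predicate). (Sources: Hironaka1967; CossartJannsenSaito2020 Ch. 8, Ch. 9 Setup B.) -/
def IsUniformDeltaCurve {Y : Scheme.{0}} (I : Y.IdealSheafData) (n a b : ℕ) (η : Y) : Prop :=
  IsCurvePt η ∧ ∀ y : Y, η ⤳ y → IsClosed ({y} : Set Y) →
    ringChar (ResidueField (Y.presheaf.stalk y)) = ringChar (ResidueField (Y.presheaf.stalk η)) ∧
      IsRelDeltaGenericAt I n a b η y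

/-- **`PackageExitsOver I n S`** — g11's `PackageExitsAt` with the point `{y}` replaced by a set `S` of points (here:
a curve): a weakly admissible sequence of blow-ups for `(I, ∅, n)`, all centres over `S`, regular top, after which every
point over `S` of order `n` for the transformed ideal has `τ ≥ 2`.  DEFINITION (NEW object; conclusion shape of the
engine, hypothesis shape of the port). (Sources: BierstoneGrigorievMilmanWlodarczyk2011 Def. 3.1.3; CossartPiltant2008
Prop. 4.2.) -/
def PackageExitsOver {Y : Scheme.{0}} (I : Y.IdealSheafData) (n : ℕ) (S : Set Y) : Prop :=
  IsLocallyNoetherian Y →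
    ∃ s : CentreSeq Y, WeakAdmissible s (⟨I, [], n⟩ : MarkedIdeal Y) ∧ s.CentresOver S ∧
      ∃ hT : Scheme.IsRegular s.top, ∀ x : s.top, s.comp x ∈ S →
        idealOrder (s.transformMarked (⟨I, [], n⟩ : MarkedIdeal Y)).ideal x = ((n : ℕ) : ℕ∞) →
          2 ≤ tauAt hT (s.transformMarked (⟨I, [], n⟩ : MarkedIdeal Y)).ideal n x

/-- **ENGINE `UniformCurvePackageExit`** [DECIDED · paper proof in the module docstring ((0r) g11's local model runs
over `R = 𝒪_{Y,y} ⊃ v` and spreads to a neighbourhood; (1r) admissibility of `C` and of the `C_j` from `J ⊆ Q(an)`;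
(2r) location `Top ∩ E_j = C_j`, which makes the centres intrinsic and GLUES the local models, regularity of the
ℙ-bundles `C_j`; covering of the points over `η`; (3r) the x-prepared expansion with `gr_x = κ[Z, U₁, W, V̄]`, readings
(N)/(I), G1/G2/G3 over `y`, and genericity at `η` by properness + semicontinuity) · characteristic free, EVERY regular
scheme, every residue field, every dimension · port L over `CentreSeq` / `controlledTransform` / `stalkTau`]: on a
regular scheme, a uniformly δ-generic curve of order `n ≥ 2` has an exit package with centres over it.  STATEMENT
(engine). (Sources: Hironaka1967; CossartJannsenSaito2020 Ch. 2, 8, 9; CossartPiltant2008 Prop. 4.2, Lemma 4.3; Moh1987.) -/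
def UniformCurvePackageExit : Prop :=
  ∀ (Y : Scheme.{0}), Scheme.IsRegular Y → ∀ (I : Y.IdealSheafData) (n : ℕ), 2 ≤ n →
    ∀ (η : Y) (a b : ℕ), IsUniformDeltaCurve I n a b η → PackageExitsOver I n {y : Y | η ⤳ y}

/-- **CURVE-EXIT point** (`IsCurveExitPt I n y`): `y` lies on (or is the generic point of) a Top-isolated
one-dimensional `closure {η}` carrying an exit package.  DEFINITION (NEW class; hypothesis shape of the port).
[folklore] -/
def IsCurveExitPt {Y : Scheme.{0}} (I : Y.IdealSheafData) (n : ℕ) (y : Y) : Prop :=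
  ∃ η : Y, η ⤳ y ∧ IsCurvePt η ∧ IsTopIsolatedClosure I n η ∧ PackageExitsOver I n {y' : Y | η ⤳ y'}

/-- **`CurvePackagePort n`** [COSTUME(M+) · engine-free bookkeeping, g11's `PackagePort` with CURVE UNITS; proof in the
module docstring: the units (isolated closed exit points; Top-isolated curves with packages) are pairwise disjoint
connected components of the noetherian top locus, finitely many; process them one at a time, transporting everything
off the processed unit by the isomorphism, then apply `SeqDimFour 2 n` to the transformed fresh datum and concatenate]:
if every top point of a dim-4 datum is of class ≥ 2, a class-2-form exit point (g10), a package-exit point (g11) or a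
curve-exit point, then `SeqDimFour 2 n` already yields a weak resolution.  STATEMENT (port). (Sources:
BierstoneGrigorievMilmanWlodarczyk2011 Def. 3.1.3; CossartPiltant2008 Prop. 4.2 (a); CossartJannsenSaito2020 Ch. 2.) -/
def CurvePackagePort (n : ℕ) : Prop :=
  SeqDimFour 2 n →
  ∀ p : ℕ, p.Prime → ∀ (k : Type) [Field k] [CharP k p]
    (Y : Scheme.{0}) (g : Y ⟶ Spec (.of k)), IsSeparated g → LocallyOfFiniteType g → QuasiCompact g →
    ∀ hY : Scheme.IsRegular Y, topologicalKrullDim Y ≤ 4 →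
    ∀ I : Y.IdealSheafData, (∀ y : Y, idealOrder I y ≤ ((n : ℕ) : ℕ∞)) →
      (∀ y : Y, idealOrder I y = ((n : ℕ) : ℕ∞) →
        ClassGE g hY I n 2 y ∨ VeryNearCutClasses.IsNearExitPt I n y ∨ IsPackageExitPt I n y ∨
          IsCurveExitPt I n y) →
      ∃ t : CentreSeq Y, WeakResolution t (⟨I, [], n⟩ : MarkedIdeal Y)

/-! ## §4  Pointwise classes at a top point -/

/-- **CURVE-GENERIC point** (THE NEW DECIDED CLASS): `y` lies on (or is the generic point of) a Top-isolated,
UNIFORMLY δ-GENERIC curve `closure {η}`.  Such a point is never isolated in the top locus (unless `y = η` in a scheme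
where `{η}` is open in `Top`), so it is δ-special for g11 and near- and face-special for g10/g9: the class is NEW territory by
letter.  DEFINITION (NEW class). (Sources: Hironaka1967; CossartJannsenSaito2020 Ch. 8.) -/
def IsCurveGenericPt {Y : Scheme.{0}} (I : Y.IdealSheafData) (n : ℕ) (y : Y) : Prop :=
  ∃ (η : Y) (a b : ℕ), η ⤳ y ∧ IsTopIsolatedClosure I n η ∧ IsUniformDeltaCurve I n a b η

/-- **RELATIVELY SPECIAL core point** (THE LOCATED CLASS of this node): near-special (tree `VeryNearCutClasses.
IsNearSpecialPt`: not of class ≥ 2, not near-generic), not δ-generic (g11), and NOT curve-generic.  DEFINITION (NEW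
class). [folklore] -/
def IsRelSpecialPt {k : Type} [Field k] {Y : Scheme.{0}} (g : Y ⟶ Spec (.of k)) (hY : Scheme.IsRegular Y)
    (I : Y.IdealSheafData) (n : ℕ) (y : Y) : Prop :=
  VeryNearCutClasses.IsNearSpecialPt g hY I n y ∧ ¬ IsDeltaGenericPt I n y ∧ ¬ IsCurveGenericPt I n y

/-- **On a CLEAN curve** (`OnCleanCurve I n y`): `y` is a proper specialisation of a curve point `η` whose closure is
Top-isolated — the stratum predicate of the CURVE column (where the relative invariants are defined: δ-jump points,
uniformly special curves, relative slope one, pinch points).  DEFINITION (NEW stratum predicate). [folklore] -/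
def OnCleanCurve {Y : Scheme.{0}} (I : Y.IdealSheafData) (n : ℕ) (y : Y) : Prop :=
  ∃ η : Y, η ⤳ y ∧ η ≠ y ∧ IsCurvePt η ∧ IsTopIsolatedClosure I n η

/-! ## §5  The graded statements (fresh-data frame = the binders of `WeakOrderReduction.SeqDimFour`) -/

/-- **`SeqRGen n`** — weak order reduction in dimension four at marking `n` for data ALL of whose top points are of
class ≥ 2, NEAR-GENERIC (g10), δ-GENERIC (g11) or CURVE-GENERIC (g12).  [DECIDED-MOD-PORT relative to `SeqDimFour 2 n`:
`rGenRungAt_of_engines`.]  STATEMENT SCHEMA. (Sources: BierstoneGrigorievMilmanWlodarczyk2011 §3.1; CossartPiltant2008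
Prop. 4.2; Hironaka1967.) -/
def SeqRGen (n : ℕ) : Prop :=
  ∀ p : ℕ, p.Prime → ∀ (k : Type) [Field k] [CharP k p]
    (Y : Scheme.{0}) (g : Y ⟶ Spec (.of k)), IsSeparated g → LocallyOfFiniteType g → QuasiCompact g →
    ∀ hY : Scheme.IsRegular Y, topologicalKrullDim Y ≤ 4 →
    ∀ I : Y.IdealSheafData, (∀ y : Y, idealOrder I y ≤ ((n : ℕ) : ℕ∞)) →
      (∀ y : Y, idealOrder I y = ((n : ℕ) : ℕ∞) →
        ClassGE g hY I n 2 y ∨ VeryNearCutClasses.IsNearGenericPt I n y ∨ IsDeltaGenericPt I n y ∨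
          IsCurveGenericPt I n y) →
      ∃ t : CentreSeq Y, WeakResolution t (⟨I, [], n⟩ : MarkedIdeal Y)

/-- **`SeqRSpec n`** — THE LOCATED CLASS: weak order reduction in dimension four at marking `n` for data having a
RELATIVELY SPECIAL core top point.  [UNDECIDED · IDEA-NEEDED · INSTRUMENTABLE T-uniform / T-delta-jump / T-round-bed.]
STATEMENT SCHEMA. (Sources: BierstoneGrigorievMilmanWlodarczyk2011 §3.1; CossartPiltant2019 Rem. 3.2; Moh1987.) -/
def SeqRSpec (n : ℕ) : Prop :=
  ∀ p : ℕ, p.Prime → ∀ (k : Type) [Field k] [CharP k p]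
    (Y : Scheme.{0}) (g : Y ⟶ Spec (.of k)), IsSeparated g → LocallyOfFiniteType g → QuasiCompact g →
    ∀ hY : Scheme.IsRegular Y, topologicalKrullDim Y ≤ 4 →
    ∀ I : Y.IdealSheafData, (∀ y : Y, idealOrder I y ≤ ((n : ℕ) : ℕ∞)) →
      (∃ y : Y, idealOrder I y = ((n : ℕ) : ℕ∞) ∧ IsRelSpecialPt g hY I n y) →
      ∃ t : CentreSeq Y, WeakResolution t (⟨I, [], n⟩ : MarkedIdeal Y)

/-- `SeqRSpecNonIso n` — NON-ISOLATED column of the located class: some relatively special core top point is NOT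
isolated in the top locus.  WEAKER BY LETTER than g11's `SeqDSpecNonIso n` (the curve-generic points have left).
[UNDECIDED · sub-cut `seqRSpecNonIso_iff` into CURVE ∧ TANGLE.] (Sources: CossartJannsenSaito2020 Ch. 5;
CossartPiltant2019 Rem. 3.2.) -/
def SeqRSpecNonIso (n : ℕ) : Prop :=
  ∀ p : ℕ, p.Prime → ∀ (k : Type) [Field k] [CharP k p]
    (Y : Scheme.{0}) (g : Y ⟶ Spec (.of k)), IsSeparated g → LocallyOfFiniteType g → QuasiCompact g →
    ∀ hY : Scheme.IsRegular Y, topologicalKrullDim Y ≤ 4 →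
    ∀ I : Y.IdealSheafData, (∀ y : Y, idealOrder I y ≤ ((n : ℕ) : ℕ∞)) →
      (∃ y : Y, idealOrder I y = ((n : ℕ) : ℕ∞) ∧ IsRelSpecialPt g hY I n y ∧
        ¬ FaceFormCutClasses.IsIsolatedTop I n y) →
      ∃ t : CentreSeq Y, WeakResolution t (⟨I, [], n⟩ : MarkedIdeal Y)

/-- `SeqRSpecIso n` — ISOLATED column of the located class: relatively special core top points exist and every one of
them is isolated in the top locus (bed, in frame: the three binary towers of g11's Iso column).  [UNDECIDED ·
INSTRUMENTABLE T-delta-tower (g11).] (Sources: Hironaka1967; Moh1987.) -/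
def SeqRSpecIso (n : ℕ) : Prop :=
  ∀ p : ℕ, p.Prime → ∀ (k : Type) [Field k] [CharP k p]
    (Y : Scheme.{0}) (g : Y ⟶ Spec (.of k)), IsSeparated g → LocallyOfFiniteType g → QuasiCompact g →
    ∀ hY : Scheme.IsRegular Y, topologicalKrullDim Y ≤ 4 →
    ∀ I : Y.IdealSheafData, (∀ y : Y, idealOrder I y ≤ ((n : ℕ) : ℕ∞)) →
      (∃ y : Y, idealOrder I y = ((n : ℕ) : ℕ∞) ∧ IsRelSpecialPt g hY I n y) →
      (∀ y : Y, idealOrder I y = ((n : ℕ) : ℕ∞) → IsRelSpecialPt g hY I n y →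
        FaceFormCutClasses.IsIsolatedTop I n y) →
      ∃ t : CentreSeq Y, WeakResolution t (⟨I, [], n⟩ : MarkedIdeal Y)

/-- `SeqRSpecCurve n` — CURVE stratum of the non-isolated column: some non-isolated relatively special core top point
lies ON A CLEAN CURVE (a Top-isolated one-dimensional `closure {η}` through it).  Here live: δ-JUMP points (bed `KV59`,
`insep xy¹⁰ / xy²⁶` — the generic package run through the jump point still exits: IDEA-NEEDED = relative genericity over
`𝒪_{C,y}`, the `v`-adic order of the face coefficient entering reading (N)), relative slope ONE («FLAT-1»: Whitney and
`y²z` in `p = 2`, `w³u`, `x³t` in `p = 3` — one blow-up of the curve resolves: IDEA-NEEDED = normal-cone-jump exit),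
uniformly δ-special curves («FLAT-δ»: `yz⁴`, `xy⁴`, `w⁹u`, Narasimhan's threefold — Round material BY
NAME 30458/30459),
pinch points (`τ(η) ≥ 2 > τ(y)`) and singular Top-isolated curves.  [UNDECIDED · INSTRUMENTABLE T-delta-jump / T-uniform
· IDEA-NEEDED as named.] (Sources: CossartJannsenSaito2020 Ch. 8–9; CossartPiltant2008 Prop. 4.2; Narasimhan1983.) -/
def SeqRSpecCurve (n : ℕ) : Prop :=
  ∀ p : ℕ, p.Prime → ∀ (k : Type) [Field k] [CharP k p]
    (Y : Scheme.{0}) (g : Y ⟶ Spec (.of k)), IsSeparated g → LocallyOfFiniteType g → QuasiCompact g →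
    ∀ hY : Scheme.IsRegular Y, topologicalKrullDim Y ≤ 4 →
    ∀ I : Y.IdealSheafData, (∀ y : Y, idealOrder I y ≤ ((n : ℕ) : ℕ∞)) →
      (∃ y : Y, idealOrder I y = ((n : ℕ) : ℕ∞) ∧ IsRelSpecialPt g hY I n y ∧
        ¬ FaceFormCutClasses.IsIsolatedTop I n y ∧ OnCleanCurve I n y) →
      ∃ t : CentreSeq Y, WeakResolution t (⟨I, [], n⟩ : MarkedIdeal Y)

/-- `SeqRSpecTangle n` — TANGLE stratum of the non-isolated column: non-isolated relatively special core top points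
exist and NONE of them lies on a clean curve (crossings of top curves `z² + x³y³`, `HauserK2/K3`; top surfaces
`CossartPiltant2019 Rem. 3.2`, `toric3`, `toyAK`; curves through surfaces).  In g7 currency: Round material
(`RoundCodimTwoAll` 30458 DECIDED, `RoundCodimThreePrincipalAll` 30459 KNOWN-MOD-PORT, `RoundCodimThreeAll` 30460
UNDECIDED for non-principal ideals).  [UNDECIDED · INSTRUMENTABLE T-round-bed · BY-NAME edge to g7 is the map edge
`closes_closedPointCore`.] (Sources: CossartJannsenSaito2020 Ch. 5; CossartPiltant2019 Rem. 3.2.) -/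
def SeqRSpecTangle (n : ℕ) : Prop :=
  ∀ p : ℕ, p.Prime → ∀ (k : Type) [Field k] [CharP k p]
    (Y : Scheme.{0}) (g : Y ⟶ Spec (.of k)), IsSeparated g → LocallyOfFiniteType g → QuasiCompact g →
    ∀ hY : Scheme.IsRegular Y, topologicalKrullDim Y ≤ 4 →
    ∀ I : Y.IdealSheafData, (∀ y : Y, idealOrder I y ≤ ((n : ℕ) : ℕ∞)) →
      (∃ y : Y, idealOrder I y = ((n : ℕ) : ℕ∞) ∧ IsRelSpecialPt g hY I n y ∧
        ¬ FaceFormCutClasses.IsIsolatedTop I n y) →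
      (∀ y : Y, idealOrder I y = ((n : ℕ) : ℕ∞) → IsRelSpecialPt g hY I n y →
        ¬ FaceFormCutClasses.IsIsolatedTop I n y → ¬ OnCleanCurve I n y) →
      ∃ t : CentreSeq Y, WeakResolution t (⟨I, [], n⟩ : MarkedIdeal Y)

/-- `RGenRungAt n` — the decided rung at one marking: `SeqDimFour 2 n → SeqRGen n`.  [DECIDED-MOD-PORT, `n ≥ 2`:
`rGenRungAt_of_engines`; `n = 1`: `rGenRungAt_one`.] [folklore] -/
def RGenRungAt (n : ℕ) : Prop := SeqDimFour 2 n → SeqRGen n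

/-- **`RelGenericRung`** — the DECIDED half of `RungOne`: `E 2 →` weak order reduction for every marking and all data
whose core top points are near-generic, δ-generic or curve-generic.  [WEAKER · DECIDED-MOD-PORT(M+):
`relGenericRung_of_engines`.]  STATEMENT (decided piece). (Sources: CossartPiltant2008 Prop. 4.2; Hironaka1967;
CossartJannsenSaito2020 Ch. 8.) -/
def RelGenericRung : Prop := E 2 → ∀ n : ℕ, 1 ≤ n → SeqRGen n

/-- **`RelSpecialRung`** — THE LOCATED RESIDUAL of this node: `E 2 →` weak order reduction for every marking and all
data with a relatively special core top point.  [WEAKER BY LETTER · UNDECIDED · IDEA-NEEDED · cofinal ⇒ score 0.]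
STATEMENT (located residual). (Sources: CossartPiltant2019 Rem. 3.2; Moh1987; Giraud1975.) -/
def RelSpecialRung : Prop := E 2 → ∀ n : ℕ, 1 ≤ n → SeqRSpec n


end Summit.ResolutionOfSingularities.ResolutionOfSingularities.Theorems.RelativeDeltaCut
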